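import Literature.AlgebraicGeometry.HodgeTheory.BettiHodgeConjectureProductsAlgebraicCorrespondences
import Literature.AlgebraicGeometry.HodgeTheory.BettiKunnethPieceCorrespondenceActionInjective
import HarnessLib

/-!
# Algebraicity of a Künneth piece is read off the actions of algebraic correspondences: `crossMap t ⊗ 1 ∈ Nᶜ(Y × Z)` iff some algebraic class acts on `H^{2n−j}(Z;ℂ)` as `t` does (one factor
# off-middle algebraic), span form, and `HC(Y × Z)` iff the Hodge classes of the pieces `Hᵐ(Y) ⊗ Hʲ(Z)` act as algebraic correspondences do
# (Voisin I §11.3.3 Lemma 11.41, pp. 286–287; Voisin II (10.7); Voisin 2025 §3.2.1 Prop. 3.8 / Cor. 3.9; Fulton §16.1)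

Family `hodge`, lane `lit-hodgefound` (Track 2 foundations library; Layers A1/A4), layer `Literature/AlgebraicGeometry/HodgeTheory`.  THEOREMS ONLY (no definition, no named fact, no instance;
D-0026 net debt `0`).  Synthesis of the seat's g30-#1 (`BettiHodgeConjectureProductsAlgebraicCorrespondences` §3: for `Y` off-middle algebraic with `HC(Y)`, `HC(Z)`, the `(m, j)`-Künneth component
of a rational ALGEBRAIC class on `Y × Z` is a Hodge class with ALGEBRAIC cross product and the same action on `H^{2n−j}(Z;ℂ)`) and g30-#2 (`BettiKunnethPieceCorrespondenceActionInjective` §2–§3: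
the action `γ ↦ γ_*` is INJECTIVE on a Künneth piece).  Together: a class `t` of the ℚ-summand `Hᵐ(Y;ℚ) ⊗ Hʲ(Z;ℚ)` whose action is that of some algebraic class `γ` IS the component of `γ`, hence
`crossMap t ⊗ 1` is algebraic; and since the action is injective on the COMPLEX piece, it is even enough that the action of `t` lie in the ℂ-span of the actions of rational algebraic classes.
Consequently `HC(Y × Z)` holds iff (⟸ needs `Y` off-middle algebraic; ⟹ holds for all `Y`, `Z`) every Hodge class of every piece `Hᵐ(Y) ⊗ Hʲ(Z)`, `1 ≤ j ≤ n`, is realised in action by an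
algebraic correspondence — «the Hodge conjecture for `Y × Z` predicts that the morphisms of Hodge structures `H^{2n−j}(Z) → Hᵐ(Y)` (Lemma 11.41) are induced by algebraic cycles».

WHAT IS PROVED.
* §1 UNIQUENESS.  **`BettiUniverse.existsUnique_kunneth_component_corrAction_eq`**: for a Hodge class `v` of `H^{2c}(Y × Z)` there is a UNIQUE `t ∈ Hⁱ(Y;ℚ) ⊗ Hʲ(Z;ℚ)` with
  `(crossMap t ⊗ 1)_* = (v ⊗ 1)_*` on `Hᵃ(Z;ℂ)` (`a + 2c = i + 2n`); **`BettiUniverse.mem_hodgeClasses_kunnethSummand_of_corrAction_eq`**: a class of the ℚ-summand acting as a Hodge class is a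
  Hodge class of the summand.
* §2 ONE OFF-MIDDLE-ALGEBRAIC FACTOR.  **`BettiUniverse.ofRatClass_crossMap_mem_algebraicClasses_of_corrAction_eq_left`** / **`…_iff_exists_corrAction_eq_left`** (and `…_right`): `Y` (resp. `Z`)
  off-middle algebraic, `HC(Y)`, `HC(Z)`; for ANY `t ∈ Hᵐ(Y;ℚ) ⊗ Hʲ(Z;ℚ)` (resp. `Hⁱ(Y;ℚ) ⊗ Hⁿ(Z;ℚ)`): `crossMap t ⊗ 1 ∈ Nᶜ(Y × Z)` iff some `γ ∈ H^{2c}(Y × Z;ℚ)` with `γ ⊗ 1 ∈ Nᶜ` acts as `t`.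
* §3 SPAN FORM.  **`BettiUniverse.ofRatClass_crossMap_mem_algebraicClasses_of_corrAction_mem_span_left`** / `…_right`: it suffices that `(crossMap t ⊗ 1)_*` lie in the ℂ-span of
  `{(γ ⊗ 1)_* : γ ∈ H^{2c}(Y × Z;ℚ), γ ⊗ 1 ∈ Nᶜ}` (via **`BettiUniverse.exists_mem_kunnethPiece_mem_algebraicClasses_corrAction_eq_of_mem_span_left`** / `…_right`).
* §4 `HC` CRITERIA.  **`BettiUniverse.forall_exists_corrAction_eq_of_hodgeConjectureFor_tensor`** (⟹, all `Y`, `Z`); **`BettiUniverse.hodgeConjectureFor_tensor_iff_forall_exists_corrAction_eq_left`** /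
  `…_right` (IFF for an off-middle-algebraic factor); **`BettiUniverse.hodgeConjectureFor_tensor_of_offMiddle_algebraic_left_of_corrAction_mem_span`** / `…_right` (span form); both factors
  off-middle algebraic, single piece `Hᵐ(Y) ⊗ Hⁿ(Z)`: **`BettiUniverse.hodgeConjectureFor_tensor_of_offMiddle_algebraic_iff_forall_exists_corrAction_eq`**; the square:
  **`BettiUniverse.hodgeConjectureFor_tensor_self_of_offMiddle_algebraic_iff`** (`HC(X × X)` iff every Hodge class of `Hⁿ(X) ⊗ Hⁿ(X)` acts on `Hⁿ(X;ℂ)` as some algebraic correspondence does).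
* §5 SMOOTH HYPERSURFACES (Voisin II Cor. 1.24/1.25, tree theorems): **`IsSmoothHypersurface.hodgeConjectureFor_tensor_self_iff_of_odd`**, **`IsSmoothHypersurface.hodgeConjectureFor_tensor_hypersurface_iff_of_odd_of_odd`**.

THE PRINTS.  C. Voisin (2002) [VoisinHodgeI2002] §11.1.2 Prop. 11.20; §11.3.3 Thm. 11.38–11.40, Lemma 11.41 and pp. 286–287.  C. Voisin (2003) [VoisinHodgeII2003] §1.2.3 Cor. 1.24–1.25; §10.2.2 proof of
Thm. 10.17, (10.7).  C. Voisin (2025) [Voisin2025] §3.2.1 (12)–(14), Prop. 3.8, Cor. 3.9.  W. Fulton (1998) [Fulton1998] §16.1 Prop. 16.1.1–16.1.2, Def. 16.1.2.  A. Hatcher (2002) [HatcherAT2002] §3.3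
Prop. 3.38.  P. Deligne (2000/2006) [Deligne2000] §1.

THE OBJECTS (all the tree's).  `corrAction μ hY hZ hab γ : Hᵃ(Z;ℂ) →ₗ Hⁱ(Y;ℂ)`, `kunnethPiece`, `BettiUniverse.crossMap`, `BettiUniverse.kunnethSummand`, `BettiUniverse.hodge hHD hX k`, `hodgeClasses`,
`HodgeStructure.tensor`, `bettiCohomology`, `complexBetti`, `ofRatClass`, `IsRationalClass`, `algebraicClasses`, `HodgeConjectureFor`, `IsSmoothHypersurface`.

DEVIATIONS / SCOPE.  «Off-middle algebraic» (`Hᵏ(Y;ℚ) = 0` for odd `k ≠ m`, `Hdgᵖ(H^{2p}Y) = H^{2p}(Y;ℚ)` for `2p ≠ m`) is the hypothesis that lets a single Künneth component be isolated; which algebraic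
correspondences exist is the geometry of the pair.  No definitions.

## References
* [VoisinHodgeI2002] C. Voisin, *Hodge Theory and Complex Algebraic Geometry I* (2002) — §11.1.2 Prop. 11.20; §11.3.3 Thm. 11.38, Thm. 11.40, Lemma 11.41, pp. 286–287.
* [VoisinHodgeII2003] C. Voisin, *Hodge Theory and Complex Algebraic Geometry II* (2003) — §1.2.3 Cor. 1.24–1.25; §10.2.2 proof of Thm. 10.17 (10.7).
* [Voisin2025] C. Voisin, *Cycle classes on algebraic varieties* (2025) — §3.2.1 (12)–(14), Prop. 3.8, Cor. 3.9.
* [Fulton1998] W. Fulton, *Intersection Theory* (2nd ed., 1998) — §16.1 Prop. 16.1.1, Prop. 16.1.2, Def. 16.1.2.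
* [HatcherAT2002] A. Hatcher, *Algebraic Topology* (2002) — §3.3 Prop. 3.38.
* [Deligne2000] P. Deligne, *The Hodge conjecture* (Clay problem description) — §1.

## Provenance
Lane `lit-hodgefound` (Hodge path, Track 2), prover seat `lit-hodgefound-p29` (generation 30), self-proposed row g30-#3 (synthesis of g30-#1 §3 and g30-#2 §2).
-/

noncomputable section

open scoped TensorProduct
open CategoryTheory MonoidalCategory CartesianMonoidalCategory Module Finset
open Literature.AlgebraicTopology.SingularHomology
open Literature.Geometry.Kaehler

namespace Literature.AlgebraicGeometry.HodgeTheory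

open Literature.AlgebraicGeometry.Motives
open Literature.AlgebraicGeometry.Motives.HodgeStructure

variable {m n d : ℕ} {X Y Z : SchemeOver ℂ}

/-! ### §1 Uniqueness of the Künneth component with a prescribed action -/

section Unique

variable [HodgeTensorFacts.{0, 0}] (μ : OrientationFamily)

/-- **The Künneth component acting as a Hodge class is unique.**  For a Hodge class `v` of `H^{2c}(Y × Z)` (any smooth-projective witness) and `a + 2c = i + 2n` there is a UNIQUE
`t ∈ Hⁱ(Y;ℚ) ⊗ Hʲ(Z;ℚ)` (`i + j = 2c`) with `(crossMap t ⊗ 1)_* = (v ⊗ 1)_*` on `Hᵃ(Z;ℂ)`: existence is g30-#1 §1, uniqueness is the injectivity of the action on the summand (g30-#2 §3).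
[cite: VoisinHodgeI2002, §11.3.3 Thm. 11.38–11.40, Lemma 11.41 and p. 286] -/
theorem BettiUniverse.existsUnique_kunneth_component_corrAction_eq (hHD : exists_isReal_hodgeModel) (hY : IsSmoothProjective m Y) (hZ : IsSmoothProjective n Z) (hYZ : IsSmoothProjective d (Y ⊗ Z))
    {c i j a : ℕ} (hij : i + j = 2 * c) (haj : a + j = 2 * n) (hab : a + 2 * c = i + 2 * n) {v : bettiCohomology (Y ⊗ Z) (2 * c)} (hv : v ∈ (BettiUniverse.hodge hHD hYZ (2 * c)).hodgeClasses c) :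
    ∃! t : bettiCohomology Y i ⊗[ℚ] bettiCohomology Z j,
      corrAction μ hY hZ hab (ofRatClass (ComplexPoints (Y ⊗ Z)) (2 * c) (BettiUniverse.crossMap Y Z hij t)) = corrAction μ hY hZ hab (ofRatClass (ComplexPoints (Y ⊗ Z)) (2 * c) v) := by
  obtain ⟨t, -, hact⟩ := BettiUniverse.exists_kunneth_component_corrAction_eq μ hHD hY hZ hYZ hij hab hv
  exact ⟨t, hact, fun t' ht' ↦ BettiUniverse.corrAction_crossMap_injective μ hY hZ hij haj hab (ht'.trans hact.symm)⟩

/-- **A class of the ℚ-summand acting as a Hodge class is a Hodge class of the summand** (it is the Künneth component of that Hodge class). [cite: VoisinHodgeI2002, §11.3.3 Thm. 11.38–11.40, Lemma 11.41 and p. 286] -/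
theorem BettiUniverse.mem_hodgeClasses_kunnethSummand_of_corrAction_eq (hHD : exists_isReal_hodgeModel) (hY : IsSmoothProjective m Y) (hZ : IsSmoothProjective n Z) (hYZ : IsSmoothProjective d (Y ⊗ Z))
    {c i j a : ℕ} (hij : i + j = 2 * c) (haj : a + j = 2 * n) (hab : a + 2 * c = i + 2 * n) {v : bettiCohomology (Y ⊗ Z) (2 * c)} (hv : v ∈ (BettiUniverse.hodge hHD hYZ (2 * c)).hodgeClasses c)
    {t : bettiCohomology Y i ⊗[ℚ] bettiCohomology Z j}
    (ht : corrAction μ hY hZ hab (ofRatClass (ComplexPoints (Y ⊗ Z)) (2 * c) (BettiUniverse.crossMap Y Z hij t)) = corrAction μ hY hZ hab (ofRatClass (ComplexPoints (Y ⊗ Z)) (2 * c) v)) :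
    t ∈ (BettiUniverse.kunnethSummand hHD hY hZ (2 * c) ⟨(i, j), HasAntidiagonal.mem_antidiagonal.2 hij⟩).hodgeClasses c := by
  obtain ⟨t', ht', hact⟩ := BettiUniverse.exists_kunneth_component_corrAction_eq μ hHD hY hZ hYZ hij hab hv
  obtain rfl : t = t' := BettiUniverse.corrAction_crossMap_injective μ hY hZ hij haj hab (ht.trans hact.symm)
  exact ht'

end Unique

/-! ### §2 One off-middle-algebraic factor: algebraicity is read off the action -/

section ReadOff

variable (μ : OrientationFamily)

/-- **`crossMap t ⊗ 1` is algebraic as soon as some algebraic class acts as `t` (left factor off-middle algebraic).**  Let `Y` (dimension `m`) satisfy `HC(Y)`, `Hᵏ(Y;ℚ) = 0` for odd `k ≠ m`,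
`Hdgᵖ(H^{2p}Y) = H^{2p}(Y;ℚ)` for `2p ≠ m`, and `Z` (dimension `n`) satisfy `HC(Z)`; let `t ∈ Hᵐ(Y;ℚ) ⊗ Hʲ(Z;ℚ)` (`m + j = 2c`, ANY class) and `γ ∈ H^{2c}(Y × Z;ℚ)` with `γ ⊗ 1` algebraic and
`(γ ⊗ 1)_* = (crossMap t ⊗ 1)_*` on `Hᵃ(Z;ℂ)` (`a + j = 2n`).  Then `crossMap t ⊗ 1` is algebraic: the `(m, j)`-component of `γ` has algebraic cross product and the same action (g30-#1 §3), so it IS `t`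
(g30-#2 §3). [cite: VoisinHodgeI2002, §11.3.3 Thm. 11.38–11.40, Lemma 11.41 and pp. 286–287] [cite: Voisin2025, §3.2.1 (12)–(14), Prop. 3.8 and Cor. 3.9] -/
theorem BettiUniverse.ofRatClass_crossMap_mem_algebraicClasses_of_corrAction_eq_left (hHD : exists_isReal_hodgeModel) (hY : IsSmoothProjective m Y) (hZ : IsSmoothProjective n Z)
    (hHCY : HodgeConjectureFor m Y) (hHCZ : HodgeConjectureFor n Z) (hodd : ∀ k, Odd k → k ≠ m → Module.finrank ℚ (bettiCohomology Y k) = 0)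
    (heven : ∀ p, 2 * p ≠ m → (BettiUniverse.hodge hHD hY (2 * p)).hodgeClasses p = ⊤) {c j a : ℕ} (hmj : m + j = 2 * c) (haj : a + j = 2 * n) (hab : a + 2 * c = m + 2 * n)
    {t : bettiCohomology Y m ⊗[ℚ] bettiCohomology Z j} {γ : bettiCohomology (Y ⊗ Z) (2 * c)} (hγ : ofRatClass (ComplexPoints (Y ⊗ Z)) (2 * c) γ ∈ algebraicClasses (Y ⊗ Z) c)
    (hact : corrAction μ hY hZ hab (ofRatClass (ComplexPoints (Y ⊗ Z)) (2 * c) γ) = corrAction μ hY hZ hab (ofRatClass (ComplexPoints (Y ⊗ Z)) (2 * c) (BettiUniverse.crossMap Y Z hmj t))) :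
    ofRatClass (ComplexPoints (Y ⊗ Z)) (2 * c) (BettiUniverse.crossMap Y Z hmj t) ∈ algebraicClasses (Y ⊗ Z) c := by
  haveI : HodgeTensorFacts.{0, 0} := hodgeTensorFacts_holds
  obtain ⟨t', -, halg, hact'⟩ := BettiUniverse.exists_kunneth_algebraic_corrAction_eq_left μ hHD hY hZ hHCY hHCZ hodd heven hmj hab hγ
  obtain rfl : t = t' := BettiUniverse.corrAction_crossMap_injective μ hY hZ hmj haj hab (hact.symm.trans hact'.symm)
  exact halg

/-- **IFF form (left)**: under the same hypotheses, `crossMap t ⊗ 1 ∈ Nᶜ(Y × Z)` iff some rational class `γ` of `H^{2c}(Y × Z)` with `γ ⊗ 1 ∈ Nᶜ` acts on `Hᵃ(Z;ℂ)` as `crossMap t ⊗ 1` does.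
[cite: VoisinHodgeI2002, §11.3.3 Thm. 11.38–11.40, Lemma 11.41 and pp. 286–287] [cite: Voisin2025, §3.2.1 (12)–(14), Prop. 3.8 and Cor. 3.9] -/
theorem BettiUniverse.ofRatClass_crossMap_mem_algebraicClasses_iff_exists_corrAction_eq_left (hHD : exists_isReal_hodgeModel) (hY : IsSmoothProjective m Y) (hZ : IsSmoothProjective n Z)
    (hHCY : HodgeConjectureFor m Y) (hHCZ : HodgeConjectureFor n Z) (hodd : ∀ k, Odd k → k ≠ m → Module.finrank ℚ (bettiCohomology Y k) = 0)
    (heven : ∀ p, 2 * p ≠ m → (BettiUniverse.hodge hHD hY (2 * p)).hodgeClasses p = ⊤) {c j a : ℕ} (hmj : m + j = 2 * c) (haj : a + j = 2 * n) (hab : a + 2 * c = m + 2 * n)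
    (t : bettiCohomology Y m ⊗[ℚ] bettiCohomology Z j) :
    ofRatClass (ComplexPoints (Y ⊗ Z)) (2 * c) (BettiUniverse.crossMap Y Z hmj t) ∈ algebraicClasses (Y ⊗ Z) c ↔
      ∃ γ : bettiCohomology (Y ⊗ Z) (2 * c), ofRatClass (ComplexPoints (Y ⊗ Z)) (2 * c) γ ∈ algebraicClasses (Y ⊗ Z) c ∧
        corrAction μ hY hZ hab (ofRatClass (ComplexPoints (Y ⊗ Z)) (2 * c) γ) = corrAction μ hY hZ hab (ofRatClass (ComplexPoints (Y ⊗ Z)) (2 * c) (BettiUniverse.crossMap Y Z hmj t)) :=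
  ⟨fun h ↦ ⟨_, h, rfl⟩, fun ⟨_, hγ, hact⟩ ↦ BettiUniverse.ofRatClass_crossMap_mem_algebraicClasses_of_corrAction_eq_left μ hHD hY hZ hHCY hHCZ hodd heven hmj haj hab hγ hact⟩

/-- **Right factor off-middle algebraic** (mirror): `Z` (dimension `n`) with `HC(Z)`, `Hᵏ(Z;ℚ) = 0` for odd `k ≠ n`, `Hdgᵖ(H^{2p}Z) = H^{2p}(Z;ℚ)` for `2p ≠ n`; `Y` with `HC(Y)`; `t ∈ Hⁱ(Y;ℚ) ⊗ Hⁿ(Z;ℚ)`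
(`i + n = 2c`) and an algebraic `γ` acting on `Hⁿ(Z;ℂ)` as `t` ⇒ `crossMap t ⊗ 1` algebraic. [cite: VoisinHodgeI2002, §11.3.3 Thm. 11.38–11.40, Lemma 11.41 and pp. 286–287] [cite: Voisin2025, §3.2.1 (12)–(14), Prop. 3.8 and Cor. 3.9] -/
theorem BettiUniverse.ofRatClass_crossMap_mem_algebraicClasses_of_corrAction_eq_right (hHD : exists_isReal_hodgeModel) (hY : IsSmoothProjective m Y) (hZ : IsSmoothProjective n Z)
    (hHCY : HodgeConjectureFor m Y) (hHCZ : HodgeConjectureFor n Z) (hodd : ∀ k, Odd k → k ≠ n → Module.finrank ℚ (bettiCohomology Z k) = 0)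
    (heven : ∀ p, 2 * p ≠ n → (BettiUniverse.hodge hHD hZ (2 * p)).hodgeClasses p = ⊤) {c i : ℕ} (hin : i + n = 2 * c) (hab : n + 2 * c = i + 2 * n)
    {t : bettiCohomology Y i ⊗[ℚ] bettiCohomology Z n} {γ : bettiCohomology (Y ⊗ Z) (2 * c)} (hγ : ofRatClass (ComplexPoints (Y ⊗ Z)) (2 * c) γ ∈ algebraicClasses (Y ⊗ Z) c)
    (hact : corrAction μ hY hZ hab (ofRatClass (ComplexPoints (Y ⊗ Z)) (2 * c) γ) = corrAction μ hY hZ hab (ofRatClass (ComplexPoints (Y ⊗ Z)) (2 * c) (BettiUniverse.crossMap Y Z hin t))) :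
    ofRatClass (ComplexPoints (Y ⊗ Z)) (2 * c) (BettiUniverse.crossMap Y Z hin t) ∈ algebraicClasses (Y ⊗ Z) c := by
  haveI : HodgeTensorFacts.{0, 0} := hodgeTensorFacts_holds
  obtain ⟨t', -, halg, hact'⟩ := BettiUniverse.exists_kunneth_algebraic_corrAction_eq_right μ hHD hY hZ hHCY hHCZ hodd heven hin hab hγ
  obtain rfl : t = t' := BettiUniverse.corrAction_crossMap_injective μ hY hZ hin (two_mul n).symm hab (hact.symm.trans hact'.symm)
  exact halg

/-- **IFF form (right)**. [cite: VoisinHodgeI2002, §11.3.3 Thm. 11.38–11.40, Lemma 11.41 and pp. 286–287] [cite: Voisin2025, §3.2.1 (12)–(14), Prop. 3.8 and Cor. 3.9] -/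
theorem BettiUniverse.ofRatClass_crossMap_mem_algebraicClasses_iff_exists_corrAction_eq_right (hHD : exists_isReal_hodgeModel) (hY : IsSmoothProjective m Y) (hZ : IsSmoothProjective n Z)
    (hHCY : HodgeConjectureFor m Y) (hHCZ : HodgeConjectureFor n Z) (hodd : ∀ k, Odd k → k ≠ n → Module.finrank ℚ (bettiCohomology Z k) = 0)
    (heven : ∀ p, 2 * p ≠ n → (BettiUniverse.hodge hHD hZ (2 * p)).hodgeClasses p = ⊤) {c i : ℕ} (hin : i + n = 2 * c) (hab : n + 2 * c = i + 2 * n)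
    (t : bettiCohomology Y i ⊗[ℚ] bettiCohomology Z n) :
    ofRatClass (ComplexPoints (Y ⊗ Z)) (2 * c) (BettiUniverse.crossMap Y Z hin t) ∈ algebraicClasses (Y ⊗ Z) c ↔
      ∃ γ : bettiCohomology (Y ⊗ Z) (2 * c), ofRatClass (ComplexPoints (Y ⊗ Z)) (2 * c) γ ∈ algebraicClasses (Y ⊗ Z) c ∧
        corrAction μ hY hZ hab (ofRatClass (ComplexPoints (Y ⊗ Z)) (2 * c) γ) = corrAction μ hY hZ hab (ofRatClass (ComplexPoints (Y ⊗ Z)) (2 * c) (BettiUniverse.crossMap Y Z hin t)) :=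
  ⟨fun h ↦ ⟨_, h, rfl⟩, fun ⟨_, hγ, hact⟩ ↦ BettiUniverse.ofRatClass_crossMap_mem_algebraicClasses_of_corrAction_eq_right μ hHD hY hZ hHCY hHCZ hodd heven hin hab hγ hact⟩

end ReadOff

/-! ### §3 Span form: the action lies in the ℂ-span of the actions of algebraic classes -/

section Span

variable (μ : OrientationFamily)

/-- **The ℂ-span of the actions of rational algebraic classes consists of actions of COMPLEX algebraic classes of the piece (left factor off-middle algebraic).**  Under the hypotheses of §2 (left),
every `f` in the ℂ-span of `{(γ ⊗ 1)_* | γ ∈ H^{2c}(Y × Z;ℚ), γ ⊗ 1 ∈ Nᶜ}` (actions on `Hᵃ(Z;ℂ)`, `a + 2c = m + 2n`) is `x_*` for some `x ∈ kunnethPiece Y Z (m + j = 2c)` with `x ∈ Nᶜ(Y × Z)`: the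
`(m, j)`-components (g30-#1 §3) and their ℂ-combinations (`Nᶜ` and the piece are ℂ-subspaces, `γ ↦ γ_*` is linear). [cite: VoisinHodgeI2002, §11.3.3 Thm. 11.38–11.40, Lemma 11.41 and pp. 286–287]
[cite: Voisin2025, §3.2.1 (12)–(14), Prop. 3.8 and Cor. 3.9] -/
theorem BettiUniverse.exists_mem_kunnethPiece_mem_algebraicClasses_corrAction_eq_of_mem_span_left (hHD : exists_isReal_hodgeModel) (hY : IsSmoothProjective m Y) (hZ : IsSmoothProjective n Z)
    (hHCY : HodgeConjectureFor m Y) (hHCZ : HodgeConjectureFor n Z) (hodd : ∀ k, Odd k → k ≠ m → Module.finrank ℚ (bettiCohomology Y k) = 0)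
    (heven : ∀ p, 2 * p ≠ m → (BettiUniverse.hodge hHD hY (2 * p)).hodgeClasses p = ⊤) {c j a : ℕ} (hmj : m + j = 2 * c) (hab : a + 2 * c = m + 2 * n)
    {f : complexBetti Z a →ₗ[ℂ] complexBetti Y m}
    (hf : f ∈ Submodule.span ℂ ((fun γ ↦ corrAction μ hY hZ hab (ofRatClass (ComplexPoints (Y ⊗ Z)) (2 * c) γ)) ''
      {γ : bettiCohomology (Y ⊗ Z) (2 * c) | ofRatClass (ComplexPoints (Y ⊗ Z)) (2 * c) γ ∈ algebraicClasses (Y ⊗ Z) c})) :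
    ∃ x ∈ kunnethPiece Y Z hmj, x ∈ algebraicClasses (Y ⊗ Z) c ∧ corrAction μ hY hZ hab x = f := by
  haveI : HodgeTensorFacts.{0, 0} := hodgeTensorFacts_holds
  induction hf using Submodule.span_induction with
  | mem g hg =>
    obtain ⟨γ, hγ, rfl⟩ := hg
    obtain ⟨t, -, halg, hact⟩ := BettiUniverse.exists_kunneth_algebraic_corrAction_eq_left μ hHD hY hZ hHCY hHCZ hodd heven hmj hab hγ
    exact ⟨_, ofRatClass_crossMap_mem_kunnethPiece hmj t, halg, hact⟩
  | zero => exact ⟨0, Submodule.zero_mem _, Submodule.zero_mem _, map_zero _⟩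
  | add g g' _ _ hg hg' =>
    obtain ⟨x, hx, hxa, rfl⟩ := hg
    obtain ⟨x', hx', hxa', rfl⟩ := hg'
    exact ⟨x + x', Submodule.add_mem _ hx hx', Submodule.add_mem _ hxa hxa', map_add _ _ _⟩
  | smul s g _ hg =>
    obtain ⟨x, hx, hxa, rfl⟩ := hg
    exact ⟨s • x, Submodule.smul_mem _ _ hx, Submodule.smul_mem _ _ hxa, map_smul _ _ _⟩

/-- **Span criterion (left factor off-middle algebraic).**  Under the hypotheses of §2 (left), a class `t ∈ Hᵐ(Y;ℚ) ⊗ Hʲ(Z;ℚ)` whose action on `Hᵃ(Z;ℂ)` (`a + j = 2n`) lies in the ℂ-SPAN of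
the actions of the rational algebraic classes of `H^{2c}(Y × Z)` has ALGEBRAIC `crossMap t ⊗ 1`: by the previous theorem the action is that of a complex algebraic class `x` of the same Künneth
piece, and the action is injective on the piece (g30-#2 §2), so `crossMap t ⊗ 1 = x`. [cite: VoisinHodgeI2002, §11.3.3 Thm. 11.38–11.40, Lemma 11.41 and pp. 286–287] [cite: Voisin2025, §3.2.1 (12)–(14), Prop. 3.8 and Cor. 3.9]
[cite: HatcherAT2002, §3.3 Prop. 3.38] -/
theorem BettiUniverse.ofRatClass_crossMap_mem_algebraicClasses_of_corrAction_mem_span_left (hHD : exists_isReal_hodgeModel) (hY : IsSmoothProjective m Y) (hZ : IsSmoothProjective n Z)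
    (hHCY : HodgeConjectureFor m Y) (hHCZ : HodgeConjectureFor n Z) (hodd : ∀ k, Odd k → k ≠ m → Module.finrank ℚ (bettiCohomology Y k) = 0)
    (heven : ∀ p, 2 * p ≠ m → (BettiUniverse.hodge hHD hY (2 * p)).hodgeClasses p = ⊤) {c j a : ℕ} (hmj : m + j = 2 * c) (haj : a + j = 2 * n) (hab : a + 2 * c = m + 2 * n)
    {t : bettiCohomology Y m ⊗[ℚ] bettiCohomology Z j}
    (ht : corrAction μ hY hZ hab (ofRatClass (ComplexPoints (Y ⊗ Z)) (2 * c) (BettiUniverse.crossMap Y Z hmj t)) ∈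
      Submodule.span ℂ ((fun γ ↦ corrAction μ hY hZ hab (ofRatClass (ComplexPoints (Y ⊗ Z)) (2 * c) γ)) ''
        {γ : bettiCohomology (Y ⊗ Z) (2 * c) | ofRatClass (ComplexPoints (Y ⊗ Z)) (2 * c) γ ∈ algebraicClasses (Y ⊗ Z) c})) :
    ofRatClass (ComplexPoints (Y ⊗ Z)) (2 * c) (BettiUniverse.crossMap Y Z hmj t) ∈ algebraicClasses (Y ⊗ Z) c := by
  obtain ⟨x, hx, hxa, hact⟩ := BettiUniverse.exists_mem_kunnethPiece_mem_algebraicClasses_corrAction_eq_of_mem_span_left μ hHD hY hZ hHCY hHCZ hodd heven hmj hab ht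
  rw [eq_of_mem_kunnethPiece_of_corrAction_eq μ hY hZ hmj haj hab (ofRatClass_crossMap_mem_kunnethPiece hmj t) hx hact.symm]
  exact hxa

/-- **The ℂ-span of the actions of rational algebraic classes, right factor off-middle algebraic** (actions on `Hⁿ(Z;ℂ)`, piece `Hⁱ(Y) ⊗ Hⁿ(Z)`). [cite: VoisinHodgeI2002, §11.3.3 Thm. 11.38–11.40, Lemma 11.41 and pp. 286–287]
[cite: Voisin2025, §3.2.1 (12)–(14), Prop. 3.8 and Cor. 3.9] -/
theorem BettiUniverse.exists_mem_kunnethPiece_mem_algebraicClasses_corrAction_eq_of_mem_span_right (hHD : exists_isReal_hodgeModel) (hY : IsSmoothProjective m Y) (hZ : IsSmoothProjective n Z)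
    (hHCY : HodgeConjectureFor m Y) (hHCZ : HodgeConjectureFor n Z) (hodd : ∀ k, Odd k → k ≠ n → Module.finrank ℚ (bettiCohomology Z k) = 0)
    (heven : ∀ p, 2 * p ≠ n → (BettiUniverse.hodge hHD hZ (2 * p)).hodgeClasses p = ⊤) {c i : ℕ} (hin : i + n = 2 * c) (hab : n + 2 * c = i + 2 * n)
    {f : complexBetti Z n →ₗ[ℂ] complexBetti Y i}
    (hf : f ∈ Submodule.span ℂ ((fun γ ↦ corrAction μ hY hZ hab (ofRatClass (ComplexPoints (Y ⊗ Z)) (2 * c) γ)) ''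
      {γ : bettiCohomology (Y ⊗ Z) (2 * c) | ofRatClass (ComplexPoints (Y ⊗ Z)) (2 * c) γ ∈ algebraicClasses (Y ⊗ Z) c})) :
    ∃ x ∈ kunnethPiece Y Z hin, x ∈ algebraicClasses (Y ⊗ Z) c ∧ corrAction μ hY hZ hab x = f := by
  haveI : HodgeTensorFacts.{0, 0} := hodgeTensorFacts_holds
  induction hf using Submodule.span_induction with
  | mem g hg =>
    obtain ⟨γ, hγ, rfl⟩ := hg
    obtain ⟨t, -, halg, hact⟩ := BettiUniverse.exists_kunneth_algebraic_corrAction_eq_right μ hHD hY hZ hHCY hHCZ hodd heven hin hab hγ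
    exact ⟨_, ofRatClass_crossMap_mem_kunnethPiece hin t, halg, hact⟩
  | zero => exact ⟨0, Submodule.zero_mem _, Submodule.zero_mem _, map_zero _⟩
  | add g g' _ _ hg hg' =>
    obtain ⟨x, hx, hxa, rfl⟩ := hg
    obtain ⟨x', hx', hxa', rfl⟩ := hg'
    exact ⟨x + x', Submodule.add_mem _ hx hx', Submodule.add_mem _ hxa hxa', map_add _ _ _⟩
  | smul s g _ hg =>
    obtain ⟨x, hx, hxa, rfl⟩ := hg
    exact ⟨s • x, Submodule.smul_mem _ _ hx, Submodule.smul_mem _ _ hxa, map_smul _ _ _⟩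

/-- **Span criterion (right factor off-middle algebraic).** [cite: VoisinHodgeI2002, §11.3.3 Thm. 11.38–11.40, Lemma 11.41 and pp. 286–287] [cite: Voisin2025, §3.2.1 (12)–(14), Prop. 3.8 and Cor. 3.9] [cite: HatcherAT2002, §3.3 Prop. 3.38] -/
theorem BettiUniverse.ofRatClass_crossMap_mem_algebraicClasses_of_corrAction_mem_span_right (hHD : exists_isReal_hodgeModel) (hY : IsSmoothProjective m Y) (hZ : IsSmoothProjective n Z)
    (hHCY : HodgeConjectureFor m Y) (hHCZ : HodgeConjectureFor n Z) (hodd : ∀ k, Odd k → k ≠ n → Module.finrank ℚ (bettiCohomology Z k) = 0)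
    (heven : ∀ p, 2 * p ≠ n → (BettiUniverse.hodge hHD hZ (2 * p)).hodgeClasses p = ⊤) {c i : ℕ} (hin : i + n = 2 * c) (hab : n + 2 * c = i + 2 * n)
    {t : bettiCohomology Y i ⊗[ℚ] bettiCohomology Z n}
    (ht : corrAction μ hY hZ hab (ofRatClass (ComplexPoints (Y ⊗ Z)) (2 * c) (BettiUniverse.crossMap Y Z hin t)) ∈
      Submodule.span ℂ ((fun γ ↦ corrAction μ hY hZ hab (ofRatClass (ComplexPoints (Y ⊗ Z)) (2 * c) γ)) ''
        {γ : bettiCohomology (Y ⊗ Z) (2 * c) | ofRatClass (ComplexPoints (Y ⊗ Z)) (2 * c) γ ∈ algebraicClasses (Y ⊗ Z) c})) :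
    ofRatClass (ComplexPoints (Y ⊗ Z)) (2 * c) (BettiUniverse.crossMap Y Z hin t) ∈ algebraicClasses (Y ⊗ Z) c := by
  obtain ⟨x, hx, hxa, hact⟩ := BettiUniverse.exists_mem_kunnethPiece_mem_algebraicClasses_corrAction_eq_of_mem_span_right μ hHD hY hZ hHCY hHCZ hodd heven hin hab ht
  rw [eq_of_mem_kunnethPiece_of_corrAction_eq μ hY hZ hin (two_mul n).symm hab (ofRatClass_crossMap_mem_kunnethPiece hin t) hx hact.symm]
  exact hxa

end Span

/-! ### §4 `HC(Y × Z)` iff the Hodge classes of the pieces act as algebraic correspondences do -/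

section Criteria

variable [HodgeTensorFacts.{0, 0}] (μ : OrientationFamily)

/-- **(⟹, all `Y`, `Z`) Under `HC(Y × Z)` every Hodge class of every Künneth summand acts as an algebraic class — namely as its own cross product**, which is a rational Hodge class of `H^{2c}(Y × Z)`
(Thm. 11.38/11.40) and hence algebraic. [cite: VoisinHodgeI2002, §11.3.3 Thm. 11.38–11.40 and p. 287] [cite: Deligne2000, §1] -/
theorem BettiUniverse.forall_exists_corrAction_eq_of_hodgeConjectureFor_tensor (hHD : exists_isReal_hodgeModel) (hY : IsSmoothProjective m Y) (hZ : IsSmoothProjective n Z)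
    (hYZ : IsSmoothProjective d (Y ⊗ Z)) (hHC : HodgeConjectureFor d (Y ⊗ Z)) {c i j a : ℕ} (hij : i + j = 2 * c) (hab : a + 2 * c = i + 2 * n)
    {t : bettiCohomology Y i ⊗[ℚ] bettiCohomology Z j} (ht : t ∈ (BettiUniverse.kunnethSummand hHD hY hZ (2 * c) ⟨(i, j), HasAntidiagonal.mem_antidiagonal.2 hij⟩).hodgeClasses c) :
    ∃ γ : bettiCohomology (Y ⊗ Z) (2 * c), ofRatClass (ComplexPoints (Y ⊗ Z)) (2 * c) γ ∈ algebraicClasses (Y ⊗ Z) c ∧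
      corrAction μ hY hZ hab (ofRatClass (ComplexPoints (Y ⊗ Z)) (2 * c) γ) = corrAction μ hY hZ hab (ofRatClass (ComplexPoints (Y ⊗ Z)) (2 * c) (BettiUniverse.crossMap Y Z hij t)) := by
  refine ⟨BettiUniverse.crossMap Y Z hij t, ?_, rfl⟩
  have hH : BettiUniverse.crossMap Y Z hij t ∈ (BettiUniverse.hodge hHD hYZ (2 * c)).hodgeClasses c :=
    BettiUniverse.crossMap_mem_hodgeClasses hHD hodgePQ_independent_of_hodgeModel_holds hY hZ hYZ hij c ht
  exact hHC.2 c _ (isRationalClass_ofRatClass _) ((BettiUniverse.mem_hodgeClasses_hodge_iff_isOfHodgeType hHD hYZ c _).1 hH)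

/-- **`HC(Y × Z)` IFF every Hodge class of every piece `Hᵐ(Y) ⊗ Hʲ(Z)`, `1 ≤ j ≤ n`, acts on `H^{2n−j}(Z;ℂ)` as some algebraic correspondence does (left factor off-middle algebraic).**  Let `Y`
(dimension `m`) satisfy `HC(Y)`, `Hᵏ(Y;ℚ) = 0` for odd `k ≠ m`, `Hdgᵖ(H^{2p}Y) = H^{2p}(Y;ℚ)` for `2p ≠ m`, and `Z` (dimension `n`) satisfy `HC(Z)`.  (⟸: §2 and g29-#7
`…_of_offMiddle_algebraic_left`; ⟹: the previous theorem.)  «The Hodge conjecture for `Y × Z` predicts that the morphisms of Hodge structures of Lemma 11.41 are induced by algebraic cycles.»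
[cite: VoisinHodgeI2002, §11.3.3 Thm. 11.38–11.40, Lemma 11.41 and pp. 286–287] [cite: Voisin2025, §3.2.1 (12)–(14), Prop. 3.8 and Cor. 3.9] [cite: Deligne2000, §1] -/
theorem BettiUniverse.hodgeConjectureFor_tensor_iff_forall_exists_corrAction_eq_left (hHD : exists_isReal_hodgeModel) (hY : IsSmoothProjective m Y) (hZ : IsSmoothProjective n Z)
    (hYZ : IsSmoothProjective d (Y ⊗ Z)) (hHCY : HodgeConjectureFor m Y) (hHCZ : HodgeConjectureFor n Z) (hodd : ∀ k, Odd k → k ≠ m → Module.finrank ℚ (bettiCohomology Y k) = 0)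
    (heven : ∀ p, 2 * p ≠ m → (BettiUniverse.hodge hHD hY (2 * p)).hodgeClasses p = ⊤) :
    HodgeConjectureFor d (Y ⊗ Z) ↔
      ∀ (c j a : ℕ) (hmj : m + j = 2 * c) (hab : a + 2 * c = m + 2 * n), 1 ≤ j → j ≤ n →
        ∀ t ∈ (BettiUniverse.kunnethSummand hHD hY hZ (2 * c) ⟨(m, j), HasAntidiagonal.mem_antidiagonal.2 hmj⟩).hodgeClasses c,
          ∃ γ : bettiCohomology (Y ⊗ Z) (2 * c), ofRatClass (ComplexPoints (Y ⊗ Z)) (2 * c) γ ∈ algebraicClasses (Y ⊗ Z) c ∧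
            corrAction μ hY hZ hab (ofRatClass (ComplexPoints (Y ⊗ Z)) (2 * c) γ) = corrAction μ hY hZ hab (ofRatClass (ComplexPoints (Y ⊗ Z)) (2 * c) (BettiUniverse.crossMap Y Z hmj t)) := by
  refine ⟨fun hHC c j a hmj hab _ _ t ht ↦ BettiUniverse.forall_exists_corrAction_eq_of_hodgeConjectureFor_tensor μ hHD hY hZ hYZ hHC hmj hab ht, fun h ↦ ?_⟩
  refine BettiUniverse.hodgeConjectureFor_tensor_of_offMiddle_algebraic_left hHD hY hZ hYZ hHCY hHCZ hodd heven fun c j hmj hj1 hjn t ht ↦ ?_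
  obtain ⟨γ, hγ, hact⟩ := h c j (2 * n - j) hmj (by omega) hj1 hjn t ht
  exact BettiUniverse.ofRatClass_crossMap_mem_algebraicClasses_of_corrAction_eq_left μ hHD hY hZ hHCY hHCZ hodd heven hmj (by omega) (by omega) hγ hact

/-- **`HC(Y × Z)` IFF every Hodge class of every piece `Hⁱ(Y) ⊗ Hⁿ(Z)`, `1 ≤ i ≤ m`, acts on `Hⁿ(Z;ℂ)` as some algebraic correspondence does (right factor off-middle algebraic).**
[cite: VoisinHodgeI2002, §11.3.3 Thm. 11.38–11.40, Lemma 11.41 and pp. 286–287] [cite: Voisin2025, §3.2.1 (12)–(14), Prop. 3.8 and Cor. 3.9] [cite: Deligne2000, §1] -/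
theorem BettiUniverse.hodgeConjectureFor_tensor_iff_forall_exists_corrAction_eq_right (hHD : exists_isReal_hodgeModel) (hY : IsSmoothProjective m Y) (hZ : IsSmoothProjective n Z)
    (hYZ : IsSmoothProjective d (Y ⊗ Z)) (hHCY : HodgeConjectureFor m Y) (hHCZ : HodgeConjectureFor n Z) (hodd : ∀ k, Odd k → k ≠ n → Module.finrank ℚ (bettiCohomology Z k) = 0)
    (heven : ∀ p, 2 * p ≠ n → (BettiUniverse.hodge hHD hZ (2 * p)).hodgeClasses p = ⊤) :
    HodgeConjectureFor d (Y ⊗ Z) ↔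
      ∀ (c i : ℕ) (hin : i + n = 2 * c) (hab : n + 2 * c = i + 2 * n), 1 ≤ i → i ≤ m →
        ∀ t ∈ (BettiUniverse.kunnethSummand hHD hY hZ (2 * c) ⟨(i, n), HasAntidiagonal.mem_antidiagonal.2 hin⟩).hodgeClasses c,
          ∃ γ : bettiCohomology (Y ⊗ Z) (2 * c), ofRatClass (ComplexPoints (Y ⊗ Z)) (2 * c) γ ∈ algebraicClasses (Y ⊗ Z) c ∧
            corrAction μ hY hZ hab (ofRatClass (ComplexPoints (Y ⊗ Z)) (2 * c) γ) = corrAction μ hY hZ hab (ofRatClass (ComplexPoints (Y ⊗ Z)) (2 * c) (BettiUniverse.crossMap Y Z hin t)) := by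
  refine ⟨fun hHC c i hin hab _ _ t ht ↦ BettiUniverse.forall_exists_corrAction_eq_of_hodgeConjectureFor_tensor μ hHD hY hZ hYZ hHC hin hab ht, fun h ↦ ?_⟩
  refine BettiUniverse.hodgeConjectureFor_tensor_of_offMiddle_algebraic_right hHD hY hZ hYZ hHCY hHCZ hodd heven fun c i hin hi1 him t ht ↦ ?_
  obtain ⟨γ, hγ, hact⟩ := h c i hin (by omega) hi1 him t ht
  exact BettiUniverse.ofRatClass_crossMap_mem_algebraicClasses_of_corrAction_eq_right μ hHD hY hZ hHCY hHCZ hodd heven hin (by omega) hγ hact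

/-- **Span form of the criterion (left)**: `HC(Y × Z)` as soon as, for every piece `Hᵐ(Y) ⊗ Hʲ(Z)`, `1 ≤ j ≤ n`, the actions of its Hodge classes on `H^{2n−j}(Z;ℂ)` lie in the ℂ-span of the actions
of the rational algebraic classes of `H^{2c}(Y × Z)`. [cite: VoisinHodgeI2002, §11.3.3 Thm. 11.38–11.40, Lemma 11.41 and pp. 286–287] [cite: Voisin2025, §3.2.1 (12)–(14), Prop. 3.8 and Cor. 3.9] [cite: Deligne2000, §1] -/
theorem BettiUniverse.hodgeConjectureFor_tensor_of_offMiddle_algebraic_left_of_corrAction_mem_span (hHD : exists_isReal_hodgeModel) (hY : IsSmoothProjective m Y) (hZ : IsSmoothProjective n Z)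
    (hYZ : IsSmoothProjective d (Y ⊗ Z)) (hHCY : HodgeConjectureFor m Y) (hHCZ : HodgeConjectureFor n Z) (hodd : ∀ k, Odd k → k ≠ m → Module.finrank ℚ (bettiCohomology Y k) = 0)
    (heven : ∀ p, 2 * p ≠ m → (BettiUniverse.hodge hHD hY (2 * p)).hodgeClasses p = ⊤)
    (hspan : ∀ (c j a : ℕ) (hmj : m + j = 2 * c) (hab : a + 2 * c = m + 2 * n), 1 ≤ j → j ≤ n →
      ∀ t ∈ (BettiUniverse.kunnethSummand hHD hY hZ (2 * c) ⟨(m, j), HasAntidiagonal.mem_antidiagonal.2 hmj⟩).hodgeClasses c,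
        corrAction μ hY hZ hab (ofRatClass (ComplexPoints (Y ⊗ Z)) (2 * c) (BettiUniverse.crossMap Y Z hmj t)) ∈
          Submodule.span ℂ ((fun γ ↦ corrAction μ hY hZ hab (ofRatClass (ComplexPoints (Y ⊗ Z)) (2 * c) γ)) ''
            {γ : bettiCohomology (Y ⊗ Z) (2 * c) | ofRatClass (ComplexPoints (Y ⊗ Z)) (2 * c) γ ∈ algebraicClasses (Y ⊗ Z) c})) :
    HodgeConjectureFor d (Y ⊗ Z) := by
  refine BettiUniverse.hodgeConjectureFor_tensor_of_offMiddle_algebraic_left hHD hY hZ hYZ hHCY hHCZ hodd heven fun c j hmj hj1 hjn t ht ↦ ?_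
  exact BettiUniverse.ofRatClass_crossMap_mem_algebraicClasses_of_corrAction_mem_span_left μ hHD hY hZ hHCY hHCZ hodd heven hmj (show 2 * n - j + j = 2 * n by omega) (by omega)
    (hspan c j (2 * n - j) hmj (by omega) hj1 hjn t ht)

/-- **Span form of the criterion (right)**. [cite: VoisinHodgeI2002, §11.3.3 Thm. 11.38–11.40, Lemma 11.41 and pp. 286–287] [cite: Voisin2025, §3.2.1 (12)–(14), Prop. 3.8 and Cor. 3.9] [cite: Deligne2000, §1] -/
theorem BettiUniverse.hodgeConjectureFor_tensor_of_offMiddle_algebraic_right_of_corrAction_mem_span (hHD : exists_isReal_hodgeModel) (hY : IsSmoothProjective m Y) (hZ : IsSmoothProjective n Z)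
    (hYZ : IsSmoothProjective d (Y ⊗ Z)) (hHCY : HodgeConjectureFor m Y) (hHCZ : HodgeConjectureFor n Z) (hodd : ∀ k, Odd k → k ≠ n → Module.finrank ℚ (bettiCohomology Z k) = 0)
    (heven : ∀ p, 2 * p ≠ n → (BettiUniverse.hodge hHD hZ (2 * p)).hodgeClasses p = ⊤)
    (hspan : ∀ (c i : ℕ) (hin : i + n = 2 * c) (hab : n + 2 * c = i + 2 * n), 1 ≤ i → i ≤ m →
      ∀ t ∈ (BettiUniverse.kunnethSummand hHD hY hZ (2 * c) ⟨(i, n), HasAntidiagonal.mem_antidiagonal.2 hin⟩).hodgeClasses c,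
        corrAction μ hY hZ hab (ofRatClass (ComplexPoints (Y ⊗ Z)) (2 * c) (BettiUniverse.crossMap Y Z hin t)) ∈
          Submodule.span ℂ ((fun γ ↦ corrAction μ hY hZ hab (ofRatClass (ComplexPoints (Y ⊗ Z)) (2 * c) γ)) ''
            {γ : bettiCohomology (Y ⊗ Z) (2 * c) | ofRatClass (ComplexPoints (Y ⊗ Z)) (2 * c) γ ∈ algebraicClasses (Y ⊗ Z) c})) :
    HodgeConjectureFor d (Y ⊗ Z) := by
  refine BettiUniverse.hodgeConjectureFor_tensor_of_offMiddle_algebraic_right hHD hY hZ hYZ hHCY hHCZ hodd heven fun c i hin hi1 him t ht ↦ ?_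
  exact BettiUniverse.ofRatClass_crossMap_mem_algebraicClasses_of_corrAction_mem_span_right μ hHD hY hZ hHCY hHCZ hodd heven hin (by omega) (hspan c i hin (by omega) hi1 him t ht)

/-- **Both factors off-middle algebraic: `HC(Y × Z)` IFF the Hodge classes of the single piece `Hᵐ(Y) ⊗ Hⁿ(Z)` (`m + n = 2c`) act on `Hⁿ(Z;ℂ) → Hᵐ(Y;ℂ)` as algebraic correspondences do.**
[cite: VoisinHodgeI2002, §11.3.3 Thm. 11.38–11.40, Lemma 11.41 and pp. 286–287] [cite: Voisin2025, §3.2.1 (12)–(14), Prop. 3.8 and Cor. 3.9] [cite: Deligne2000, §1] -/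
theorem BettiUniverse.hodgeConjectureFor_tensor_of_offMiddle_algebraic_iff_forall_exists_corrAction_eq (hHD : exists_isReal_hodgeModel) (hY : IsSmoothProjective m Y) (hZ : IsSmoothProjective n Z)
    (hYZ : IsSmoothProjective d (Y ⊗ Z)) (hHCY : HodgeConjectureFor m Y) (hHCZ : HodgeConjectureFor n Z)
    (hoddY : ∀ k, Odd k → k ≠ m → Module.finrank ℚ (bettiCohomology Y k) = 0) (hevenY : ∀ p, 2 * p ≠ m → (BettiUniverse.hodge hHD hY (2 * p)).hodgeClasses p = ⊤)
    (hoddZ : ∀ k, Odd k → k ≠ n → Module.finrank ℚ (bettiCohomology Z k) = 0) (hevenZ : ∀ p, 2 * p ≠ n → (BettiUniverse.hodge hHD hZ (2 * p)).hodgeClasses p = ⊤)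
    {c : ℕ} (hmn : m + n = 2 * c) (hab : n + 2 * c = m + 2 * n) :
    HodgeConjectureFor d (Y ⊗ Z) ↔
      ∀ t ∈ (BettiUniverse.kunnethSummand hHD hY hZ (2 * c) ⟨(m, n), HasAntidiagonal.mem_antidiagonal.2 hmn⟩).hodgeClasses c,
        ∃ γ : bettiCohomology (Y ⊗ Z) (2 * c), ofRatClass (ComplexPoints (Y ⊗ Z)) (2 * c) γ ∈ algebraicClasses (Y ⊗ Z) c ∧
          corrAction μ hY hZ hab (ofRatClass (ComplexPoints (Y ⊗ Z)) (2 * c) γ) = corrAction μ hY hZ hab (ofRatClass (ComplexPoints (Y ⊗ Z)) (2 * c) (BettiUniverse.crossMap Y Z hmn t)) := by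
  refine ⟨fun hHC t ht ↦ BettiUniverse.forall_exists_corrAction_eq_of_hodgeConjectureFor_tensor μ hHD hY hZ hYZ hHC hmn hab ht, fun h ↦ ?_⟩
  refine BettiUniverse.hodgeConjectureFor_tensor_of_offMiddle_algebraic hHD hY hZ hYZ hHCY hHCZ hoddY hevenY hoddZ hevenZ fun c' hc' t ht ↦ ?_
  obtain rfl : c' = c := by omega
  obtain ⟨γ, hγ, hact⟩ := h t ht
  exact BettiUniverse.ofRatClass_crossMap_mem_algebraicClasses_of_corrAction_eq_left μ hHD hY hZ hHCY hHCZ hoddY hevenY hmn (two_mul n).symm hab hγ hact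

/-- **The square: `HC(X × X)` IFF every Hodge class of `Hⁿ(X) ⊗ Hⁿ(X)` acts on `Hⁿ(X;ℂ)` as some algebraic correspondence does** (`X` off-middle algebraic of dimension `n` with `HC(X)`; g29-#11 gave
`⟸` from `dim End_HS(HⁿX) ≤ r` independent algebraic correspondences). [cite: VoisinHodgeI2002, §11.3.3 Thm. 11.38–11.40, Lemma 11.41 and pp. 286–287] [cite: Voisin2025, §3.2.1 (12)–(14), Prop. 3.8 and Cor. 3.9]
[cite: Deligne2000, §1] -/
theorem BettiUniverse.hodgeConjectureFor_tensor_self_of_offMiddle_algebraic_iff (hHD : exists_isReal_hodgeModel) (hX : IsSmoothProjective n X) (hXX : IsSmoothProjective d (X ⊗ X))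
    (hHC : HodgeConjectureFor n X) (hodd : ∀ k, Odd k → k ≠ n → Module.finrank ℚ (bettiCohomology X k) = 0) (heven : ∀ p, 2 * p ≠ n → (BettiUniverse.hodge hHD hX (2 * p)).hodgeClasses p = ⊤) :
    HodgeConjectureFor d (X ⊗ X) ↔
      ∀ t ∈ (BettiUniverse.kunnethSummand hHD hX hX (2 * n) ⟨(n, n), HasAntidiagonal.mem_antidiagonal.2 (two_mul n).symm⟩).hodgeClasses n,
        ∃ γ : bettiCohomology (X ⊗ X) (2 * n), ofRatClass (ComplexPoints (X ⊗ X)) (2 * n) γ ∈ algebraicClasses (X ⊗ X) n ∧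
          corrAction μ hX hX (rfl : n + 2 * n = n + 2 * n) (ofRatClass (ComplexPoints (X ⊗ X)) (2 * n) γ) =
            corrAction μ hX hX (rfl : n + 2 * n = n + 2 * n) (ofRatClass (ComplexPoints (X ⊗ X)) (2 * n) (BettiUniverse.crossMap X X (two_mul n).symm t)) :=
  BettiUniverse.hodgeConjectureFor_tensor_of_offMiddle_algebraic_iff_forall_exists_corrAction_eq μ hHD hX hX hXX hHC hHC hodd heven hodd heven (two_mul n).symm rfl

end Criteria

end Literature.AlgebraicGeometry.HodgeTheory

/-! ### §5 Smooth hypersurfaces -/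

namespace Literature.AlgebraicGeometry.Motives.IsSmoothHypersurface

open Literature.AlgebraicGeometry.Motives
open Literature.AlgebraicGeometry.HodgeTheory

variable {m n e e' : ℕ} {Y Y' : SchemeOver ℂ}

/-- **`HC(Y × Y)` for a smooth hypersurface of ODD dimension `m` IFF every Hodge class of `Hᵐ(Y) ⊗ Hᵐ(Y)` acts on `Hᵐ(Y;ℂ)` as an algebraic self-correspondence of `Y` does** (hypersurfaces are
off-middle algebraic with `HC` in odd dimension: Cor. 1.24/1.25, tree theorems). [cite: VoisinHodgeII2003, §1.2.3 Cor. 1.24 and Cor. 1.25] [cite: VoisinHodgeI2002, §11.3.3 Lemma 11.41 and pp. 286–287] -/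
theorem hodgeConjectureFor_tensor_self_iff_of_odd [HodgeTensorFacts.{0, 0}] (hY : IsSmoothHypersurface m e Y) (μ : OrientationFamily) (hHD : exists_isReal_hodgeModel) (hm : Odd m) :
    HodgeConjectureFor (m + m) (Y ⊗ Y) ↔
      ∀ t ∈ (BettiUniverse.kunnethSummand hHD hY.1 hY.1 (2 * m) ⟨(m, m), HasAntidiagonal.mem_antidiagonal.2 (two_mul m).symm⟩).hodgeClasses m,
        ∃ γ : bettiCohomology (Y ⊗ Y) (2 * m), ofRatClass (ComplexPoints (Y ⊗ Y)) (2 * m) γ ∈ algebraicClasses (Y ⊗ Y) m ∧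
          corrAction μ hY.1 hY.1 (rfl : m + 2 * m = m + 2 * m) (ofRatClass (ComplexPoints (Y ⊗ Y)) (2 * m) γ) =
            corrAction μ hY.1 hY.1 (rfl : m + 2 * m = m + 2 * m) (ofRatClass (ComplexPoints (Y ⊗ Y)) (2 * m) (BettiUniverse.crossMap Y Y (two_mul m).symm t)) :=
  BettiUniverse.hodgeConjectureFor_tensor_self_of_offMiddle_algebraic_iff μ hHD hY.1 (hY.1.tensor_holds hY.1) (hY.hodgeConjectureFor_of_odd hHD hm)
    (fun _ hk hkm ↦ hY.finrank_bettiCohomology_eq_zero_of_odd hk hkm) (fun _ hp ↦ hY.hodgeClasses_hodge_eq_top_of_two_mul_ne hHD hY.1 hp)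

/-- **`HC(Y × Y')` for two smooth hypersurfaces of ODD dimensions `m`, `n` (`m + n = 2c`) IFF every Hodge class of `Hᵐ(Y) ⊗ Hⁿ(Y')` acts on `Hⁿ(Y';ℂ) → Hᵐ(Y;ℂ)` as an algebraic correspondence does.**
[cite: VoisinHodgeII2003, §1.2.3 Cor. 1.24 and Cor. 1.25] [cite: VoisinHodgeI2002, §11.3.3 Lemma 11.41 and pp. 286–287] -/
theorem hodgeConjectureFor_tensor_hypersurface_iff_of_odd_of_odd [HodgeTensorFacts.{0, 0}] (hY : IsSmoothHypersurface m e Y) (hY' : IsSmoothHypersurface n e' Y') (μ : OrientationFamily)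
    (hHD : exists_isReal_hodgeModel) (hm : Odd m) (hn : Odd n) {c : ℕ} (hmn : m + n = 2 * c) (hab : n + 2 * c = m + 2 * n) :
    HodgeConjectureFor (m + n) (Y ⊗ Y') ↔
      ∀ t ∈ (BettiUniverse.kunnethSummand hHD hY.1 hY'.1 (2 * c) ⟨(m, n), HasAntidiagonal.mem_antidiagonal.2 hmn⟩).hodgeClasses c,
        ∃ γ : bettiCohomology (Y ⊗ Y') (2 * c), ofRatClass (ComplexPoints (Y ⊗ Y')) (2 * c) γ ∈ algebraicClasses (Y ⊗ Y') c ∧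
          corrAction μ hY.1 hY'.1 hab (ofRatClass (ComplexPoints (Y ⊗ Y')) (2 * c) γ) = corrAction μ hY.1 hY'.1 hab (ofRatClass (ComplexPoints (Y ⊗ Y')) (2 * c) (BettiUniverse.crossMap Y Y' hmn t)) :=
  BettiUniverse.hodgeConjectureFor_tensor_of_offMiddle_algebraic_iff_forall_exists_corrAction_eq μ hHD hY.1 hY'.1 (hY.1.tensor_holds hY'.1) (hY.hodgeConjectureFor_of_odd hHD hm)
    (hY'.hodgeConjectureFor_of_odd hHD hn) (fun _ hk hkm ↦ hY.finrank_bettiCohomology_eq_zero_of_odd hk hkm) (fun _ hp ↦ hY.hodgeClasses_hodge_eq_top_of_two_mul_ne hHD hY.1 hp)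
    (fun _ hk hkn ↦ hY'.finrank_bettiCohomology_eq_zero_of_odd hk hkn) (fun _ hp ↦ hY'.hodgeClasses_hodge_eq_top_of_two_mul_ne hHD hY'.1 hp) hmn hab

end Literature.AlgebraicGeometry.Motives.IsSmoothHypersurface

end
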